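/-
Copyright: cell pub-balaban-gaps, seat ne8 (estimate NE7c), gen 17. Project licence.
-/
import Summits.Ventures.LatticeQCDFlow.Scaling.SpecialUnitarySmallBall
import Literature.RepresentationTheory.CompactGroups.WeylIntegrationSpecialUnitary

/-!
# EXPONENTIAL versus CAYLEY coordinates of `U(N)` near `1`: the trace direction `d = i·1`, the near-identity estimate `‖ichart(exp(skewOf y)) − y‖ ≤ c‖y‖`,
# and the exponential coordinates `u = exp(skewOf(a + φ·d))` (`a ∈ 𝔰𝔲(N)`, `φ = arg det u ∕ N`) of a unitary whose special part is near `1` — step B1a of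
# VALUING the small-ball constant `C₀(SU(N))` of this seat's file 36 (row NE7c, HANDOFF § GEN 16 open point (vi′); [folklore])

Cell `pub-balaban-gaps` (G2), seat ne8, estimate **NE7c**.  Proof-only file under `Spine/NE7c/`: imports the tree's
`Summits/Ventures/LatticeQCDFlow/Scaling/SpecialUnitarySmallBall` (cell pub-lqcd: `suAlg`, `imTrace`, `suChart`, `suChart_fill`, `suChart_biLipschitz`,
`exp_sub_exp_approx`, over `Literature/…/UnitaryCayleyChart`'s Hilbert–Schmidt coordinates `𝔼 N ≅ 𝔲(N)`, `skewOf`, `unskew`, `chart`, `ichart`,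
`norm_cay_sub_taylor_le`) and `Literature/RepresentationTheory/CompactGroups/WeylIntegrationSpecialUnitary` (`specialPart`, `detPhase`, `coe_eq_detPhase_smul`),
all BY NAME.  No `def`; 0 `sorry`.  ROUTE B for `C₀(SU(N))`: B0 = file 40 `LiveFactorSUNCentralTube`, B2 = file 41 `LiveFactorCylinderVolume`, B1b =
`LiveFactorSUNTubeChart` (the tube ↔ cylinder squeeze, which consumes this file), B3 assembly — none of their content is claimed here.

THIS FILE ([folklore]):
* §1 the direction `d = unskew(i·1)` of `𝔼 N` (`skewOf d = i·1`, `⟪x, d⟫ = imTrace x`, `‖d‖ = √N`), the trace coordinate `τ x = imTrace x ∕ N` and the projection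
  `P₀ x = x − τ(x)·d` onto `d^⊥ = 𝔰𝔲(N)`: PYTHAGORAS `‖P₀ x‖² = ‖x‖² − N·τ(x)²` (`norm_proj_sq`), hence `‖P₀ x‖ ≤ ‖x‖` and `√N·|τ x| ≤ ‖x‖`; on exponential
  coordinates `τ(a + φ·d) = φ` (`tau_expCoords`), `skewOf(a + φ·d) = skewOf a + (φ i)·1`, `exp((c)·1) = e^c·1`, and **`exp_skewOf_expCoords`**:
  `exp(skewOf(a + φ·d)) = e^{iφ}·exp(skewOf a)` (`i·1` is central);
* §2 **`norm_ichart_exp_sub_le`** — for every `c > 0` there is `r > 0` with `‖exp(skewOf y) − 1‖ ≤ 2‖y‖ < 2` and `‖ichart(exp(skewOf y)) − y‖ ≤ c‖y‖` for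
  `‖y‖ ≤ r` (both `cay` and `exp` osculate the identity at `0`: `norm_cay_sub_taylor_le`, `exp_sub_exp_approx`);
* §3 **`exists_expCoords`** — for every `ε > 0` there is `r > 0` such that every `u ∈ U(N)` with `‖specialPart u − 1‖ ≤ s ≤ r` is `exp(skewOf(a + φ·d))` with
  `a ∈ 𝔰𝔲(N)`, `exp(skewOf a) = specialPart u`, `‖a‖ ≤ (1+ε)s`, `‖specialPart u − 1‖ ≤ (1+ε)‖a‖`, `φ = arg(det u)∕N` (`suChart_fill`, `suChart_biLipschitz`,
  `u = ζ(u)·specialPart u`); `exists_abs_arg_det_lt` (continuity of `arg ∘ det` at `1 ∈ U(N)`); `norm_specialPart_sub_one_le`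
  (`‖specialPart u − 1‖ ≤ ‖u − 1‖ + |arg det u ∕ N|·√N`).

HONEST: metric geometry of two charts of `U(N)` ([folklore]); nothing of the interacting measure, nothing of Bałaban's; `C₀(SU(N))` is NOT valued in this file.
NE7c NOT proved; WORD UNCHANGED (WORK-bound behind node O; INSTANCE 0∕1); spine 0∕9; one finite T⁴ — NOT ℝ⁴, NOT infinite volume, NOT the mass gap, NOT Clay.
-/

set_option autoImplicit false

noncomputable section

open scoped Matrix.Norms.Frobenius Real ComplexConjugate Matrix
open MeasureTheory Set Filter Complex Metric NormedSpace
open Literature.MathematicalPhysics.QuantumFieldTheory (haarProbability)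
open Literature.MathematicalPhysics.QuantumFieldTheory.UnitaryCayley (𝔼 𝔾 skewOf unskew skewOf_unskew unskew_skewOf unskew_apply skewOf_apply
  conjTranspose_skewOf cay icay chart ichart coe_chart chart_ichart ichart_chart norm_chart_sub_one_le norm_ichart_le norm_cay_sub_taylor_le
  frobenius_norm_sq)
open Literature.RepresentationTheory.CompactGroups.WeylIntegration (detPhase specialPart coe_specialPart coe_eq_detPhase_smul norm_det_eq_one)
open Summit.Ventures.LatticeQCDFlow.Theory2.Lattice.SUN (imTrace imTrace_apply suAlg suChart coe_suChart suChart_zero dist_suChart suChart_fill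
  suChart_biLipschitz exp_sub_exp_approx imTrace_unskew_I_smul_one)

namespace Summit.QuantumFields.BalabanUV.T4Continuum.Spine.NE7c.LiveFactorSUNTubeCoords


variable {N : ℕ}

/-! ## §1 The direction `d = unskew(i·1)` of `𝔼 N ≅ 𝔲(N)`, the trace coordinate `τ = imTrace ∕ N`, the projection `P₀ x = x − τ(x)·d` -/

/-- `i·1` is skew-Hermitian. [folklore] -/
theorem conjTranspose_I_smul_one : ((I : ℂ) • (1 : Matrix (Fin N) (Fin N) ℂ))ᴴ = -((I : ℂ) • 1) := by
  rw [Matrix.conjTranspose_smul, Matrix.conjTranspose_one, Complex.star_def, Complex.conj_I, neg_smul]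

/-- `skewOf d = i·1`. [folklore] -/
theorem skewOf_d : skewOf (unskew ((I : ℂ) • (1 : Matrix (Fin N) (Fin N) ℂ))) = (I : ℂ) • 1 :=
  skewOf_unskew conjTranspose_I_smul_one

/-- the inner product with `d` is the trace coordinate: `⟪x, d⟫ = imTrace x = Σ_j x_{jj}`. [folklore] -/
theorem inner_d_eq_imTrace (x : 𝔼 N) : inner ℝ x (unskew ((I : ℂ) • (1 : Matrix (Fin N) (Fin N) ℂ))) = imTrace N x := by
  rw [imTrace_apply, Matrix.trace, PiLp.inner_apply]
  rw [Complex.im_sum]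
  simp only [Matrix.diag_apply, skewOf_apply, RCLike.inner_apply, conj_trivial, unskew_apply, Matrix.smul_apply, Matrix.one_apply,
    smul_eq_mul, mul_ite, mul_one, mul_zero]
  rw [Fintype.sum_prod_type]
  refine Finset.sum_congr rfl fun j _ => ?_
  rw [Finset.sum_eq_single j]
  · simp
  · intro k _ hkj; simp [Ne.symm hkj]
  · intro h; exact absurd (Finset.mem_univ j) h

/-- `‖d‖² = N`. [folklore] -/
theorem norm_d_sq : ‖unskew ((I : ℂ) • (1 : Matrix (Fin N) (Fin N) ℂ))‖ ^ 2 = N := by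
  rw [← real_inner_self_eq_norm_sq, inner_d_eq_imTrace, imTrace_unskew_I_smul_one]

/-- `‖d‖ = √N`. [folklore] -/
theorem norm_d : ‖unskew ((I : ℂ) • (1 : Matrix (Fin N) (Fin N) ℂ))‖ = Real.sqrt N := by
  rw [← norm_d_sq, Real.sqrt_sq (norm_nonneg _)]

/-- `τ d = 1` in the form `imTrace d = N`. (the tree's `imTrace_unskew_I_smul_one`) -/
theorem imTrace_d : imTrace N (unskew ((I : ℂ) • (1 : Matrix (Fin N) (Fin N) ℂ))) = N := imTrace_unskew_I_smul_one

/-- **PYTHAGORAS FOR THE TRACE COORDINATE** (`N ≥ 1`): `‖x − τ(x)·d‖² = ‖x‖² − N·τ(x)²`, `τ x = imTrace x ∕ N`. [folklore] -/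
theorem norm_proj_sq [NeZero N] (x : 𝔼 N) :
    ‖x - (imTrace N x / N) • unskew ((I : ℂ) • (1 : Matrix (Fin N) (Fin N) ℂ))‖ ^ 2 = ‖x‖ ^ 2 - N * (imTrace N x / N) ^ 2 := by
  have hN : (N : ℝ) ≠ 0 := Nat.cast_ne_zero.2 (NeZero.ne N)
  rw [norm_sub_sq_real, real_inner_smul_right, inner_d_eq_imTrace, norm_smul, mul_pow, norm_d_sq, Real.norm_eq_abs, sq_abs]
  field_simp
  ring

/-- the projection is a contraction: `‖x − τ(x)·d‖ ≤ ‖x‖`. [folklore] -/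
theorem norm_proj_le [NeZero N] (x : 𝔼 N) :
    ‖x - (imTrace N x / N) • unskew ((I : ℂ) • (1 : Matrix (Fin N) (Fin N) ℂ))‖ ≤ ‖x‖ := by
  have h := norm_proj_sq x
  have h2 : 0 ≤ (N : ℝ) * (imTrace N x / N) ^ 2 := by positivity
  nlinarith [norm_nonneg x, norm_nonneg (x - (imTrace N x / N) • unskew ((I : ℂ) • (1 : Matrix (Fin N) (Fin N) ℂ)))]

/-- the trace coordinate is `1∕√N`-Lipschitz: `√N·|τ x| ≤ ‖x‖`. [folklore] -/
theorem sqrt_mul_abs_tau_le [NeZero N] (x : 𝔼 N) : Real.sqrt N * |imTrace N x / N| ≤ ‖x‖ := by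
  have h := norm_proj_sq x
  have h1 : 0 ≤ ‖x - (imTrace N x / N) • unskew ((I : ℂ) • (1 : Matrix (Fin N) (Fin N) ℂ))‖ ^ 2 := sq_nonneg _
  have h3 : (Real.sqrt N * |imTrace N x / N|) ^ 2 = N * (imTrace N x / N) ^ 2 := by
    rw [mul_pow, Real.sq_sqrt (Nat.cast_nonneg N), sq_abs]
  have h4 : (Real.sqrt N * |imTrace N x / N|) ^ 2 ≤ ‖x‖ ^ 2 := by rw [h3]; linarith
  have ha : 0 ≤ Real.sqrt N * |imTrace N x / N| := by positivity
  exact (pow_le_pow_iff_left₀ ha (norm_nonneg x) two_ne_zero).1 h4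

/-- `τ` and `P₀` on exponential coordinates: for `a ∈ 𝔰𝔲(N)`, `τ(a + φ·d) = φ` and `P₀(a + φ·d) = a` (`N ≥ 1`). [folklore] -/
theorem tau_expCoords [NeZero N] (a : suAlg N) (φ : ℝ) :
    imTrace N ((a : 𝔼 N) + φ • unskew ((I : ℂ) • (1 : Matrix (Fin N) (Fin N) ℂ))) / N = φ := by
  have hN : (N : ℝ) ≠ 0 := Nat.cast_ne_zero.2 (NeZero.ne N)
  have ha : imTrace N (a : 𝔼 N) = 0 := LinearMap.mem_ker.1 a.2
  rw [map_add, map_smul, ha, imTrace_d, smul_eq_mul, zero_add, mul_div_cancel_right₀ _ hN]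

/-- `skewOf (a + φ·d) = skewOf a + (φ i)·1`. [folklore] -/
theorem skewOf_expCoords (a : 𝔼 N) (φ : ℝ) :
    skewOf (a + φ • unskew ((I : ℂ) • (1 : Matrix (Fin N) (Fin N) ℂ))) = skewOf a + ((φ : ℂ) * I) • (1 : Matrix (Fin N) (Fin N) ℂ) := by
  rw [map_add, map_smul, skewOf_d, RCLike.real_smul_eq_coe_smul (K := ℂ), smul_smul]
  rfl

/-- `exp((c)·1) = e^c·1` for matrices. [folklore] -/
theorem exp_smul_one (c : ℂ) : exp (c • (1 : Matrix (Fin N) (Fin N) ℂ)) = cexp c • (1 : Matrix (Fin N) (Fin N) ℂ) := by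
  have h := algebraMap_exp_comm (𝕂 := ℂ) (𝔸 := Matrix (Fin N) (Fin N) ℂ) c
  rw [Algebra.algebraMap_eq_smul_one, Algebra.algebraMap_eq_smul_one, ← congr_fun Complex.exp_eq_exp_ℂ c] at h
  exact h.symm

/-- **EXPONENTIAL COORDINATES MULTIPLY THE PHASE IN**: `exp(skewOf(a + φ·d)) = e^{iφ}·exp(skewOf a)` (`i·1` is central). [folklore] -/
theorem exp_skewOf_expCoords (a : 𝔼 N) (φ : ℝ) :
    exp (skewOf (a + φ • unskew ((I : ℂ) • (1 : Matrix (Fin N) (Fin N) ℂ)))) = cexp (φ * I) • exp (skewOf a) := by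
  calc exp (skewOf (a + φ • unskew ((I : ℂ) • (1 : Matrix (Fin N) (Fin N) ℂ))))
      = exp (skewOf a + ((φ : ℂ) * I) • (1 : Matrix (Fin N) (Fin N) ℂ)) := by rw [skewOf_expCoords]
    _ = exp (skewOf a) * exp (((φ : ℂ) * I) • (1 : Matrix (Fin N) (Fin N) ℂ)) :=
        NormedSpace.exp_add_of_commute ((Commute.one_right (skewOf a)).smul_right ((φ : ℂ) * I))
    _ = exp (skewOf a) * (cexp ((φ : ℂ) * I) • (1 : Matrix (Fin N) (Fin N) ℂ)) := by rw [exp_smul_one]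
    _ = cexp (φ * I) • exp (skewOf a) := by rw [Matrix.mul_smul, mul_one]

/-! ## §2 Cayley coordinates of `exp(skewOf y)`: the near-identity estimate `‖ichart(exp(skewOf y)) − y‖ ≤ c·‖y‖` -/

/-- `exp(skewOf y)` is unitary. [folklore] -/
theorem exp_skewOf_mem_unitaryGroup (y : 𝔼 N) : exp (skewOf y) ∈ Matrix.unitaryGroup (Fin N) ℂ :=
  exp_mem_unitary_of_mem_skewAdjoint (by rw [skewAdjoint.mem_iff, Matrix.star_eq_conjTranspose, conjTranspose_skewOf])

/-- the Taylor remainder of the Cayley transform at first order: `‖cay X − 1 − X‖ ≤ ‖X‖²∕2 + ‖X‖³∕4` (from the tree's cubic remainder). [folklore] -/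
theorem norm_cay_sub_one_sub_le (x : 𝔼 N) :
    ‖cay (skewOf x) - 1 - skewOf x‖ ≤ ‖x‖ ^ 2 / 2 + ‖x‖ ^ 3 / 4 := by
  set X := skewOf x with hX
  have hXn : ‖X‖ = ‖x‖ := (skewOf (N := N)).norm_map x
  have h1 := norm_cay_sub_taylor_le (conjTranspose_skewOf x)
  rw [← hX] at h1
  have hsplit : cay X - 1 - X = (cay X - (1 + X + (2 : ℂ)⁻¹ • (X * X))) + (2 : ℂ)⁻¹ • (X * X) := by
    abel
  rw [hsplit]
  calc ‖(cay X - (1 + X + (2 : ℂ)⁻¹ • (X * X))) + (2 : ℂ)⁻¹ • (X * X)‖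
      ≤ ‖cay X - (1 + X + (2 : ℂ)⁻¹ • (X * X))‖ + ‖(2 : ℂ)⁻¹ • (X * X)‖ := norm_add_le _ _
    _ ≤ ‖X‖ ^ 3 / 4 + ‖X‖ ^ 2 / 2 := by
        refine add_le_add h1 ?_
        rw [norm_smul, norm_inv, Complex.norm_two]
        have := Matrix.frobenius_norm_mul X X
        nlinarith [norm_nonneg X]
    _ = ‖x‖ ^ 2 / 2 + ‖x‖ ^ 3 / 4 := by rw [hXn]; ring

/-- **THE NEAR-IDENTITY ESTIMATE**: for every `c > 0` there is `r > 0` such that for `‖y‖ ≤ r` the unitary `u = exp(skewOf y)` lies in the Cayley chart's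
range (`‖u − 1‖ < 2`, indeed `≤ 2‖y‖`) and its Cayley coordinates satisfy `‖ichart u − y‖ ≤ c·‖y‖` (both `cay` and `exp` osculate the identity). [folklore] -/
theorem norm_ichart_exp_sub_le {c : ℝ} (hc : 0 < c) : ∃ r : ℝ, 0 < r ∧ ∀ y : 𝔼 N, ‖y‖ ≤ r →
    ‖exp (skewOf y) - 1‖ ≤ 2 * ‖y‖ ∧ ‖exp (skewOf y) - 1‖ < 2 ∧
    ‖ichart (⟨exp (skewOf y), exp_skewOf_mem_unitaryGroup y⟩ : 𝔾 N) - y‖ ≤ c * ‖y‖ := by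
  obtain ⟨δ₁, hδ₁, hexp⟩ := exp_sub_exp_approx (N := N) (c := min (c / 2) 1) (by positivity)
  refine ⟨min (δ₁ / 2) (min (1 / 4) (c / 100)), by positivity, fun y hy => ?_⟩
  have hy1 : ‖y‖ ≤ δ₁ / 2 := hy.trans (min_le_left _ _)
  have hy2 : ‖y‖ ≤ 1 / 4 := hy.trans ((min_le_right _ _).trans (min_le_left _ _))
  have hy3 : ‖y‖ ≤ c / 100 := hy.trans ((min_le_right _ _).trans (min_le_right _ _))
  set Y := skewOf y with hY
  have hYn : ‖Y‖ = ‖y‖ := (skewOf (N := N)).norm_map y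
  have hE := hexp Y 0 (by rw [hYn]; linarith) (by rw [norm_zero]; exact hδ₁)
  rw [NormedSpace.exp_zero, sub_zero] at hE
  have hmin1 : min (c / 2) 1 ≤ 1 := min_le_right _ _
  have hmin2 : min (c / 2) 1 ≤ c / 2 := min_le_left _ _
  have hu1 : ‖exp Y - 1‖ ≤ 2 * ‖y‖ := by
    calc ‖exp Y - 1‖ = ‖(exp Y - 1 - Y) + Y‖ := by rw [sub_add_cancel]
      _ ≤ ‖exp Y - 1 - Y‖ + ‖Y‖ := norm_add_le _ _
      _ ≤ min (c / 2) 1 * ‖Y‖ + ‖Y‖ := by gcongr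
      _ ≤ 2 * ‖y‖ := by rw [hYn]; nlinarith [norm_nonneg y]
  have hu2 : ‖exp Y - 1‖ < 2 := by linarith
  refine ⟨hu1, hu2, ?_⟩
  set u : 𝔾 N := ⟨exp Y, exp_skewOf_mem_unitaryGroup y⟩ with hu
  have hcoe : (u : Matrix (Fin N) (Fin N) ℂ) = exp Y := rfl
  set x := ichart u with hx
  -- `cay (skewOf x) = exp Y`
  have hcay : cay (skewOf x) = exp Y := by
    have h := congrArg (fun v : 𝔾 N => (v : Matrix (Fin N) (Fin N) ℂ)) (chart_ichart (U := u) (by rw [hcoe]; exact hu2))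
    simpa only [coe_chart, hcoe] using h
  -- `‖x‖ ≤ 4‖y‖`
  have hxn : ‖x‖ ≤ 4 * ‖y‖ := by
    have h := norm_ichart_le (U := u) (by rw [hcoe]; exact hu2)
    rw [hcoe, ← hx] at h
    have ha : 0 ≤ (1 / 2 - ‖exp Y - 1‖) * ‖x‖ := mul_nonneg (by linarith) (norm_nonneg x)
    nlinarith [norm_nonneg x]
  -- the main estimate
  have hT := norm_cay_sub_one_sub_le x
  have hXY : skewOf x - Y = (exp Y - 1 - Y) - (cay (skewOf x) - 1 - skewOf x) := by rw [hcay]; abel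
  calc ‖x - y‖ = ‖skewOf x - Y‖ := by rw [hY, ← map_sub, LinearIsometry.norm_map]
    _ = ‖(exp Y - 1 - Y) - (cay (skewOf x) - 1 - skewOf x)‖ := by rw [hXY]
    _ ≤ ‖exp Y - 1 - Y‖ + ‖cay (skewOf x) - 1 - skewOf x‖ := norm_sub_le _ _
    _ ≤ min (c / 2) 1 * ‖y‖ + (‖x‖ ^ 2 / 2 + ‖x‖ ^ 3 / 4) := by rw [← hYn]; exact add_le_add hE hT
    _ ≤ c / 2 * ‖y‖ + ((4 * ‖y‖) ^ 2 / 2 + (4 * ‖y‖) ^ 3 / 4) := by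
        gcongr
    _ ≤ c * ‖y‖ := by nlinarith [norm_nonneg y, mul_nonneg (norm_nonneg y) (norm_nonneg y)]

/-! ## §3 Exponential coordinates of a unitary whose special part is near `1` -/

/-- **EXPONENTIAL COORDINATES**: for every `ε > 0` there is `r > 0` such that every `u ∈ U(N)` with `‖specialPart u − 1‖ ≤ s ≤ r` is
`u = exp(skewOf(a + φ·d))` with `a ∈ 𝔰𝔲(N)`, `exp(skewOf a) = specialPart u`, `‖a‖ ≤ (1 + ε)s`, `φ = arg(det u)∕N` (`N ≥ 1`; the tree's `suChart_fill` and
`suChart_biLipschitz`, and `u = ζ(u)·specialPart u`). [folklore] -/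
theorem exists_expCoords [NeZero N] {ε : ℝ} (hε : 0 < ε) : ∃ r : ℝ, 0 < r ∧ ∀ (u : 𝔾 N) (s : ℝ), 0 ≤ s → s ≤ r →
    ‖((specialPart u : Matrix.specialUnitaryGroup (Fin N) ℂ) : Matrix (Fin N) (Fin N) ℂ) - 1‖ ≤ s →
    ∃ a : suAlg N, ‖(a : 𝔼 N)‖ ≤ (1 + ε) * s ∧
      exp (skewOf (a : 𝔼 N)) = ((specialPart u : Matrix.specialUnitaryGroup (Fin N) ℂ) : Matrix (Fin N) (Fin N) ℂ) ∧
      ‖((specialPart u : Matrix.specialUnitaryGroup (Fin N) ℂ) : Matrix (Fin N) (Fin N) ℂ) - 1‖ ≤ (1 + ε) * ‖(a : 𝔼 N)‖ ∧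
      exp (skewOf ((a : 𝔼 N) + (arg (u : Matrix (Fin N) (Fin N) ℂ).det / N) • unskew ((I : ℂ) • (1 : Matrix (Fin N) (Fin N) ℂ))))
        = (u : Matrix (Fin N) (Fin N) ℂ) := by
  obtain ⟨r₀, hr₀, hfill⟩ := suChart_fill (N := N)
  obtain ⟨r, hr, -, hlip, hcolip⟩ := suChart_biLipschitz (N := N) hε hr₀
  refine ⟨min r₀ (r / 2), by positivity, fun u s hs0 hs hW => ?_⟩
  set W : Matrix.specialUnitaryGroup (Fin N) ℂ := specialPart u with hWdef
  have hsr₀ : s ≤ r₀ := hs.trans (min_le_left _ _)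
  have hsr : 2 * s ≤ r := by linarith [hs.trans (min_le_right _ _)]
  have hmem : W ∈ closedBall (1 : Matrix.specialUnitaryGroup (Fin N) ℂ) s := by
    rw [mem_closedBall, Subtype.dist_eq, dist_eq_norm]; exact hW
  obtain ⟨a, ha, haW⟩ := hfill s hs0 hsr₀ hmem
  rw [mem_closedBall, dist_zero_right] at ha
  have ha0 : a ∈ closedBall (0 : suAlg N) r := by rw [mem_closedBall, dist_zero_right]; linarith
  have h00 : (0 : suAlg N) ∈ closedBall (0 : suAlg N) r := by rw [mem_closedBall, dist_self]; exact hr.le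
  have hexpW : exp (skewOf (a : 𝔼 N)) = (W : Matrix (Fin N) (Fin N) ℂ) := by rw [← coe_suChart, haW]
  have hdist : dist (suChart a) (suChart 0) = ‖(W : Matrix (Fin N) (Fin N) ℂ) - 1‖ := by
    rw [haW, suChart_zero, Subtype.dist_eq, dist_eq_norm]; rfl
  refine ⟨a, ?_, hexpW, ?_, ?_⟩
  · have h := hcolip a ha0 0 h00
    rw [sub_zero, hdist] at h
    exact h.trans (mul_le_mul_of_nonneg_left hW (by linarith))
  · have h := hlip a ha0 0 h00
    rw [sub_zero, hdist] at h
    exact h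
  · rw [exp_skewOf_expCoords, hexpW, hWdef]
    conv_rhs => rw [coe_eq_detPhase_smul u]
    congr 1
    simp only [detPhase, Fintype.card_fin]

/-! ## §3b Continuity of `arg ∘ det` at `1` and the size of the special part -/

/-- `arg ∘ det` is continuous at `1 ∈ U(N)`: for every `η > 0` there is `s > 0` with `|arg det u| < η` whenever `‖u − 1‖ < s`. [folklore] -/
theorem exists_abs_arg_det_lt {η : ℝ} (hη : 0 < η) : ∃ s : ℝ, 0 < s ∧ ∀ u : 𝔾 N,
    ‖(u : Matrix (Fin N) (Fin N) ℂ) - 1‖ < s → |arg (u : Matrix (Fin N) (Fin N) ℂ).det| < η := by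
  have h1 : ((1 : 𝔾 N) : Matrix (Fin N) (Fin N) ℂ).det = 1 := by simp
  have hc : ContinuousAt (fun u : 𝔾 N => arg (u : Matrix (Fin N) (Fin N) ℂ).det) 1 := by
    have hdet : Continuous fun u : 𝔾 N => (u : Matrix (Fin N) (Fin N) ℂ).det := Continuous.matrix_det continuous_subtype_val
    have harg : ContinuousAt arg ((fun u : 𝔾 N => (u : Matrix (Fin N) (Fin N) ℂ).det) 1) :=
      Complex.continuousAt_arg (by simp only [h1]; exact Complex.one_mem_slitPlane)
    exact ContinuousAt.comp (g := arg) (f := fun u : 𝔾 N => (u : Matrix (Fin N) (Fin N) ℂ).det) (x := 1) harg hdet.continuousAt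
  obtain ⟨s, hs, h⟩ := (Metric.continuousAt_iff.1 hc) η hη
  refine ⟨s, hs, fun u hu => ?_⟩
  have := @h u (by rwa [Subtype.dist_eq, dist_eq_norm])
  rwa [Real.dist_eq, h1, Complex.arg_one, sub_zero] at this

/-- the special part is Lipschitz-close to `u`: `‖specialPart u − 1‖ ≤ ‖u − 1‖ + |arg det u ∕ N|·√N` (`N ≥ 1`). [folklore] -/
theorem norm_specialPart_sub_one_le [NeZero N] (u : 𝔾 N) :
    ‖((specialPart u : Matrix.specialUnitaryGroup (Fin N) ℂ) : Matrix (Fin N) (Fin N) ℂ) - 1‖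
      ≤ ‖(u : Matrix (Fin N) (Fin N) ℂ) - 1‖ + |arg (u : Matrix (Fin N) (Fin N) ℂ).det / N| * Real.sqrt N := by
  set ζ : ℂ := detPhase (u : Matrix (Fin N) (Fin N) ℂ) with hζ
  have hζ1 : ‖ζ‖ = 1 := Literature.RepresentationTheory.CompactGroups.WeylIntegration.norm_detPhase _
  have hζ0 : ζ ≠ 0 := Literature.RepresentationTheory.CompactGroups.WeylIntegration.detPhase_ne_zero _
  have hsp : ((specialPart u : Matrix.specialUnitaryGroup (Fin N) ℂ) : Matrix (Fin N) (Fin N) ℂ) = ζ⁻¹ • (u : Matrix (Fin N) (Fin N) ℂ) :=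
    coe_specialPart u
  -- `ζ⁻¹ u − 1 = ζ⁻¹ (u − 1) + (ζ⁻¹ − 1)·1`
  have hdec : ζ⁻¹ • (u : Matrix (Fin N) (Fin N) ℂ) - 1 = ζ⁻¹ • ((u : Matrix (Fin N) (Fin N) ℂ) - 1) + (ζ⁻¹ - 1) • (1 : Matrix (Fin N) (Fin N) ℂ) := by
    rw [smul_sub, sub_smul, one_smul]; abel
  have hone : ‖(1 : Matrix (Fin N) (Fin N) ℂ)‖ = Real.sqrt N := by
    have h := frobenius_norm_sq (1 : Matrix (Fin N) (Fin N) ℂ)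
    simp only [Matrix.one_apply, apply_ite norm, norm_one, norm_zero, ite_pow, one_pow, zero_pow two_ne_zero, Finset.sum_ite_eq,
      Finset.mem_univ, if_true, Finset.sum_const, Finset.card_univ, Fintype.card_fin, nsmul_eq_mul, mul_one] at h
    rw [← Real.sqrt_sq (norm_nonneg (1 : Matrix (Fin N) (Fin N) ℂ)), h]
  have hζinv : ‖ζ⁻¹ - 1‖ ≤ |arg (u : Matrix (Fin N) (Fin N) ℂ).det / N| := by
    -- `‖ζ⁻¹ − 1‖ = ‖1 − ζ‖ = ‖ζ − 1‖ ≤ |φ|`, `ζ = e^{iφ}`, `φ = arg det u ∕ N`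
    have h1 : ζ⁻¹ - 1 = -(ζ⁻¹ * (ζ - 1)) := by field_simp; ring
    rw [h1, norm_neg, norm_mul, norm_inv, hζ1, inv_one, one_mul, hζ]
    unfold detPhase
    rw [Fintype.card_fin, mul_comm]
    exact le_trans Real.norm_exp_I_mul_ofReal_sub_one_le (le_of_eq (Real.norm_eq_abs _))
  rw [hsp, hdec]
  calc ‖ζ⁻¹ • ((u : Matrix (Fin N) (Fin N) ℂ) - 1) + (ζ⁻¹ - 1) • (1 : Matrix (Fin N) (Fin N) ℂ)‖
      ≤ ‖ζ⁻¹ • ((u : Matrix (Fin N) (Fin N) ℂ) - 1)‖ + ‖(ζ⁻¹ - 1) • (1 : Matrix (Fin N) (Fin N) ℂ)‖ := norm_add_le _ _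
    _ = ‖(u : Matrix (Fin N) (Fin N) ℂ) - 1‖ + ‖ζ⁻¹ - 1‖ * Real.sqrt N := by
        rw [norm_smul, norm_smul, norm_inv, hζ1, inv_one, one_mul, hone]
    _ ≤ ‖(u : Matrix (Fin N) (Fin N) ℂ) - 1‖ + |arg (u : Matrix (Fin N) (Fin N) ℂ).det / N| * Real.sqrt N := by
        gcongr

end Summit.QuantumFields.BalabanUV.T4Continuum.Spine.NE7c.LiveFactorSUNTubeCoords
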